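import Summits.MatrixMultiplication.OmegaCensus.STPPVosperTilingWords

/-!
# ω-census (abelian STPP census): soundness of the exact-cover checker with words (kernel)

HONEST FRAMING (pub-omega census; verbatim): lottery ticket; floor = certified bounds/negative ranges.
Census STRUCTURE (seat pub-omega-stpp-1 gen 32, 2026-08-28), family (b2).  Second half of `STPPVosperTilingWords.lean`: one block with the required
properties is realised inside `blockDiffsW` (`exists_lists_mem_blockDiffsW`), and the finset-level SOUNDNESS theorem `existsCoverW_complete` of the checker
`existsCoverW` (exact cover of the two Vosper progressions by the other blocks' difference sets, with the Def-5.1 words among those blocks), obtained from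
the list-level `existsCoverW_complete_list`.  So a kernel verdict `existsCoverW … = false` excludes such blocks.  UNCONDITIONAL (no Hamidoune–Rødseth).
Nothing here is progress on `ω`.

References: H. Cohn, R. Kleinberg, B. Szegedy, C. Umans, FOCS 2005 (arXiv:math/0511460), Def. 5.1; A. G. Vosper, J. London Math. Soc. 31 (1956).
-/

open Finset
open scoped Pointwise

namespace Summit.MatrixMultiplication.OmegaCensus.CubeNB

open Literature.Computability.AlgebraicComplexity
open Literature.Combinatorics.Additive
open Summit.MatrixMultiplication.OmegaCensus.STPPKneser

/-! ## §3 Realising one block inside `blockDiffsW` -/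

section SoundBlock

/-- `wordsIn` holds for lists whose elements satisfy the three within-block words. [folklore] -/
theorem wordsIn_of_forall {p : ℕ} {YL ZL C B A : List ℕ}
    (h1 : ∀ a₁ ∈ A, ∀ a₂ ∈ A, a₁ ≠ a₂ → ∀ b ∈ B, ∀ c ∈ C, ((a₁ + p - b) % p + (c + p - a₂) % p) % p ∉ YL)
    (h2 : ∀ b₁ ∈ B, ∀ b₂ ∈ B, b₁ ≠ b₂ → ∀ c ∈ C, ∀ a ∈ A, ((c + p - b₁) % p + p - (a + p - b₂) % p) % p ∉ ZL)
    (h3 : ∀ c₁ ∈ C, ∀ c₂ ∈ C, c₁ ≠ c₂ → ∀ b ∈ B, ∀ a ∈ A, ((c₁ + p - b) % p + p - (c₂ + p - a) % p) % p ∉ diffList p A B) :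
    wordsIn p YL ZL C B A = true := by
  rw [wordsIn]
  simp only [Bool.and_eq_true, List.all_eq_true, Bool.or_eq_true, decide_eq_true_eq, Bool.not_eq_true', decide_eq_false_iff_not]
  refine ⟨⟨fun a₁ ha₁ a₂ ha₂ => ?_, fun b₁ hb₁ b₂ hb₂ => ?_⟩, fun c₁ hc₁ c₂ hc₂ => ?_⟩
  · by_cases h : a₁ = a₂
    · exact Or.inl h
    · exact Or.inr fun b hb c hc => h1 a₁ ha₁ a₂ ha₂ h b hb c hc
  · by_cases h : b₁ = b₂
    · exact Or.inl h
    · exact Or.inr fun c hc a ha => h2 b₁ hb₁ b₂ hb₂ h c hc a ha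
  · by_cases h : c₁ = c₂
    · exact Or.inl h
    · exact Or.inr fun b hb a ha => h3 c₁ hc₁ c₂ hc₂ h b hb a ha

/-- Membership in `blockDiffsW` (the witnesses spelled out). [folklore] -/
theorem mem_blockDiffsW {p : ℕ} {YL ZL : List ℕ} {a b c : ℕ} {C B' A : List ℕ}
    (hC : C ∈ YL.sublistsLen c) (hB : B' ∈ ((candShift p C fun y => decide (y ∈ YL)).filter fun x => x != 0).sublistsLen (b - 1))
    (hA : A ∈ (candShift p C fun t => decide (t ∈ ZL)).sublistsLen a)
    (h1 : (diffList p C (0 :: B')).Nodup) (h2 : (diffList p C A).Nodup) (h3 : (diffList p A (0 :: B')).Nodup)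
    (hw : wordsIn p YL ZL C (0 :: B') A = true) :
    (diffList p C (0 :: B'), diffList p C A, diffList p A (0 :: B')) ∈ blockDiffsW p YL ZL a b c := by
  rw [blockDiffsW, List.mem_flatMap]
  refine ⟨C, hC, ?_⟩
  rw [List.mem_flatMap]
  refine ⟨B', hB, ?_⟩
  rw [List.mem_filterMap]
  refine ⟨A, hA, ?_⟩
  simp [blockTriple, h1, h2, h3, hw]

/-- **One block is realised inside `blockDiffsW`.**  Value finsets `Av, Bv, Cv ⊆ [0, p)` of sizes `(a, b, c)` with `0 ∈ Bv`, all `(c − x) mod p`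
(`x ∈ Bv`) among the duplicate-free Y-points `YL`, all `(c − x) mod p` (`x ∈ Av`) among `ZL`, the three difference maps injective and the three within-block
words: then lists `Al, Bl, Cl` enumerating `Av, Bv, Cv` exist whose value triple lies in `blockDiffsW p YL ZL a b c`. [folklore] -/
theorem exists_lists_mem_blockDiffsW {p : ℕ} {YL ZL : List ℕ} (hYL : YL.Nodup) {a b c : ℕ} (Av Bv Cv : Finset ℕ)
    (hszA : #Av = a) (hszB : #Bv = b) (hszC : #Cv = c)
    (hAp : ∀ x ∈ Av, x < p) (hBp : ∀ x ∈ Bv, x < p) (hCp : ∀ x ∈ Cv, x < p) (hB0 : 0 ∈ Bv)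
    (hY : ∀ c ∈ Cv, ∀ x ∈ Bv, (c + p - x) % p ∈ YL) (hZ : ∀ c ∈ Cv, ∀ x ∈ Av, (c + p - x) % p ∈ ZL)
    (hinjY : ∀ c ∈ Cv, ∀ c' ∈ Cv, ∀ x ∈ Bv, ∀ x' ∈ Bv, (c + p - x) % p = (c' + p - x') % p → c = c' ∧ x = x')
    (hinjZ : ∀ c ∈ Cv, ∀ c' ∈ Cv, ∀ x ∈ Av, ∀ x' ∈ Av, (c + p - x) % p = (c' + p - x') % p → c = c' ∧ x = x')
    (hinjX : ∀ c ∈ Av, ∀ c' ∈ Av, ∀ x ∈ Bv, ∀ x' ∈ Bv, (c + p - x) % p = (c' + p - x') % p → c = c' ∧ x = x')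
    (hw1 : ∀ a₁ ∈ Av, ∀ a₂ ∈ Av, a₁ ≠ a₂ → ∀ y ∈ Bv, ∀ c ∈ Cv, ((a₁ + p - y) % p + (c + p - a₂) % p) % p ∉ YL)
    (hw2 : ∀ b₁ ∈ Bv, ∀ b₂ ∈ Bv, b₁ ≠ b₂ → ∀ c ∈ Cv, ∀ x ∈ Av, ((c + p - b₁) % p + p - (x + p - b₂) % p) % p ∉ ZL)
    (hw3 : ∀ c₁ ∈ Cv, ∀ c₂ ∈ Cv, c₁ ≠ c₂ → ∀ y ∈ Bv, ∀ x ∈ Av, ∀ x' ∈ Av, ∀ y' ∈ Bv,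
      ((c₁ + p - y) % p + p - (c₂ + p - x) % p) % p ≠ (x' + p - y') % p) :
    ∃ Al Bl Cl : List ℕ, (∀ x, x ∈ Al ↔ x ∈ Av) ∧ (∀ x, x ∈ Bl ↔ x ∈ Bv) ∧ (∀ x, x ∈ Cl ↔ x ∈ Cv) ∧
      (diffList p Cl Bl, diffList p Cl Al, diffList p Al Bl) ∈ blockDiffsW p YL ZL a b c := by
  -- the lists realising the block (as in `existsCover_complete`)
  have hCsub : ∀ x ∈ Cv, x ∈ YL := by
    intro x hx
    have h := hY x hx 0 hB0
    rwa [Nat.sub_zero, Nat.add_mod_right, Nat.mod_eq_of_lt (hCp x hx)] at h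
  set Cl := YL.filter (fun x => decide (x ∈ Cv)) with hCl
  set candB := (candShift p Cl fun y => decide (y ∈ YL)).filter (fun x => x != 0) with hcandB
  set Bl := candB.filter (fun x => decide (x ∈ Bv.erase 0)) with hBl
  set candA := candShift p Cl (fun t => decide (t ∈ ZL)) with hcandA
  set Al := candA.filter (fun x => decide (x ∈ Av)) with hAl
  have hClmem : ∀ x, x ∈ Cl ↔ x ∈ Cv := by
    intro x; rw [hCl, List.mem_filter, decide_eq_true_eq]; exact ⟨fun h => h.2, fun h => ⟨hCsub x h, h⟩⟩
  have hClnd : Cl.Nodup := hYL.filter _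
  have hCllen : Cl.length = c := by rw [hCl, length_filter_mem_of_subset hYL hCsub, hszC]
  have hBsub : ∀ x ∈ Bv.erase 0, x ∈ candB := by
    intro x hx
    rw [Finset.mem_erase] at hx
    rw [hcandB, List.mem_filter, mem_candShift]
    refine ⟨⟨hBp x hx.2, fun c' hc' => ?_⟩, by simpa using hx.1⟩
    rw [decide_eq_true_eq]
    exact hY c' ((hClmem c').1 hc') x hx.2
  have hcandBnd : candB.Nodup := ((List.nodup_range).filter _).filter _
  have hBlmem : ∀ x, x ∈ Bl ↔ x ∈ Bv.erase 0 := by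
    intro x; rw [hBl, List.mem_filter, decide_eq_true_eq]; exact ⟨fun h => h.2, fun h => ⟨hBsub x h, h⟩⟩
  have hBlnd : Bl.Nodup := hcandBnd.filter _
  have hBllen : Bl.length = b - 1 := by
    rw [hBl, length_filter_mem_of_subset hcandBnd hBsub, Finset.card_erase_of_mem hB0, hszB]
  have hB0l : ∀ x, x ∈ (0 :: Bl) ↔ x ∈ Bv := by
    intro x; rw [List.mem_cons, hBlmem, Finset.mem_erase]
    constructor
    · rintro (rfl | ⟨-, h⟩); exacts [hB0, h]
    · intro h; by_cases h0 : x = 0; exacts [Or.inl h0, Or.inr ⟨h0, h⟩]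
  have hB0nd : (0 :: Bl).Nodup := by
    rw [List.nodup_cons]; refine ⟨fun h => ?_, hBlnd⟩
    have := (hBlmem 0).1 h; simp at this
  have hAsub : ∀ x ∈ Av, x ∈ candA := by
    intro x hx
    rw [hcandA, mem_candShift]
    refine ⟨hAp x hx, fun c' hc' => ?_⟩
    rw [decide_eq_true_eq]
    exact hZ c' ((hClmem c').1 hc') x hx
  have hcandAnd : candA.Nodup := (List.nodup_range).filter _
  have hAlmem : ∀ x, x ∈ Al ↔ x ∈ Av := by
    intro x; rw [hAl, List.mem_filter, decide_eq_true_eq]; exact ⟨fun h => h.2, fun h => ⟨hAsub x h, h⟩⟩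
  have hAlnd : Al.Nodup := hcandAnd.filter _
  have hAllen : Al.length = a := by rw [hAl, length_filter_mem_of_subset hcandAnd hAsub, hszA]
  -- the three difference lists are duplicate-free
  have hn1 : (diffList p Cl (0 :: Bl)).Nodup := nodup_diffList hClnd hB0nd fun c₁ hc₁ c₂ hc₂ x₁ hx₁ x₂ hx₂ h =>
    hinjY c₁ ((hClmem _).1 hc₁) c₂ ((hClmem _).1 hc₂) x₁ ((hB0l _).1 hx₁) x₂ ((hB0l _).1 hx₂) h
  have hn2 : (diffList p Cl Al).Nodup := nodup_diffList hClnd hAlnd fun c₁ hc₁ c₂ hc₂ x₁ hx₁ x₂ hx₂ h =>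
    hinjZ c₁ ((hClmem _).1 hc₁) c₂ ((hClmem _).1 hc₂) x₁ ((hAlmem _).1 hx₁) x₂ ((hAlmem _).1 hx₂) h
  have hn3 : (diffList p Al (0 :: Bl)).Nodup := nodup_diffList hAlnd hB0nd fun c₁ hc₁ c₂ hc₂ x₁ hx₁ x₂ hx₂ h =>
    hinjX c₁ ((hAlmem _).1 hc₁) c₂ ((hAlmem _).1 hc₂) x₁ ((hB0l _).1 hx₁) x₂ ((hB0l _).1 hx₂) h
  -- the within-block words
  have hw : wordsIn p YL ZL Cl (0 :: Bl) Al = true := by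
    refine wordsIn_of_forall (fun a₁ ha₁ a₂ ha₂ hne y hy c' hc' => ?_) (fun b₁ hb₁ b₂ hb₂ hne c' hc' x hx => ?_)
      (fun c₁ hc₁ c₂ hc₂ hne y hy x hx hmem => ?_)
    · exact hw1 a₁ ((hAlmem _).1 ha₁) a₂ ((hAlmem _).1 ha₂) hne y ((hB0l _).1 hy) c' ((hClmem _).1 hc')
    · exact hw2 b₁ ((hB0l _).1 hb₁) b₂ ((hB0l _).1 hb₂) hne c' ((hClmem _).1 hc') x ((hAlmem _).1 hx)
    · obtain ⟨x', hx', y', hy', h⟩ := mem_diffList.1 hmem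
      exact hw3 c₁ ((hClmem _).1 hc₁) c₂ ((hClmem _).1 hc₂) hne y ((hB0l _).1 hy) x ((hAlmem _).1 hx) x' ((hAlmem _).1 hx')
        y' ((hB0l _).1 hy') h.symm
  exact ⟨Al, 0 :: Bl, Cl, hAlmem, hB0l, hClmem, mem_blockDiffsW (List.mem_sublistsLen.2 ⟨List.filter_sublist, hCllen⟩)
    (List.mem_sublistsLen.2 ⟨List.filter_sublist, hBllen⟩) (List.mem_sublistsLen.2 ⟨List.filter_sublist, hAllen⟩) hn1 hn2 hn3 hw⟩

end SoundBlock

/-! ## §4 Soundness of the checker -/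

section Sound

variable {ι : Type*}

/-- **Soundness of the exact-cover checker with words.**  Blocks `k` (`good k`) with value finsets `Av k, Bv k, Cv k ⊆ [0, p)` of sizes `sz k = (a,b,c)`,
`0 ∈ Bv k`, all `(c − x) mod p` (`c ∈ Cv k`, `x ∈ Bv k`) among the duplicate-free Y-points `YL`, all `(c − x) mod p` (`x ∈ Av k`) among `ZL`, the three
difference maps injective, the Def-5.1 words (`(a″ − b″) + (c′ − a′) ∉ YL` unless same block and `a″ = a′`; `(c − b) − (a″ − b″) ∉ ZL` unless same block and
`b = b″`; `(c − b) − (c′ − a′) ≠ a″ − b″` unless all three blocks coincide and `c = c′`), the difference sets of distinct blocks pairwise disjoint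
(this is the case `l ≠ k` etc. of the words together with injectivity, but we assume it explicitly), and the Y- (Z-) difference sets covering `YL` (`ZL`):
then `existsCoverW p YL ZL (ks.map fun k => blockDiffsW p YL ZL a_k b_k c_k) [] [] [] = true` for every duplicate-free list `ks` of exactly the good blocks.
[cite: CohnKleinbergSzegedyUmans2005, Def. 5.1] -/
theorem existsCoverW_complete {p : ℕ} {YL ZL : List ℕ} (hYL : YL.Nodup) (good : ι → Prop)
    (sz : ι → ℕ × ℕ × ℕ) (Av Bv Cv : ι → Finset ℕ)
    (hszA : ∀ k, good k → #(Av k) = (sz k).1) (hszB : ∀ k, good k → #(Bv k) = (sz k).2.1) (hszC : ∀ k, good k → #(Cv k) = (sz k).2.2)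
    (hAp : ∀ k, ∀ x ∈ Av k, x < p) (hBp : ∀ k, ∀ x ∈ Bv k, x < p) (hCp : ∀ k, ∀ x ∈ Cv k, x < p) (hB0 : ∀ k, good k → 0 ∈ Bv k)
    (hY : ∀ k, good k → ∀ c ∈ Cv k, ∀ x ∈ Bv k, (c + p - x) % p ∈ YL) (hZ : ∀ k, good k → ∀ c ∈ Cv k, ∀ x ∈ Av k, (c + p - x) % p ∈ ZL)
    (hinjY : ∀ k, good k → ∀ c ∈ Cv k, ∀ c' ∈ Cv k, ∀ x ∈ Bv k, ∀ x' ∈ Bv k, (c + p - x) % p = (c' + p - x') % p → c = c' ∧ x = x')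
    (hinjZ : ∀ k, good k → ∀ c ∈ Cv k, ∀ c' ∈ Cv k, ∀ x ∈ Av k, ∀ x' ∈ Av k, (c + p - x) % p = (c' + p - x') % p → c = c' ∧ x = x')
    (hinjX : ∀ k, good k → ∀ c ∈ Av k, ∀ c' ∈ Av k, ∀ x ∈ Bv k, ∀ x' ∈ Bv k, (c + p - x) % p = (c' + p - x') % p → c = c' ∧ x = x')
    (hdY : ∀ k k', good k → good k' → k ≠ k' → ∀ c ∈ Cv k, ∀ x ∈ Bv k, ∀ c' ∈ Cv k', ∀ x' ∈ Bv k', (c + p - x) % p ≠ (c' + p - x') % p)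
    (hdZ : ∀ k k', good k → good k' → k ≠ k' → ∀ c ∈ Cv k, ∀ x ∈ Av k, ∀ c' ∈ Cv k', ∀ x' ∈ Av k', (c + p - x) % p ≠ (c' + p - x') % p)
    (hdX : ∀ k k', good k → good k' → k ≠ k' → ∀ c ∈ Av k, ∀ x ∈ Bv k, ∀ c' ∈ Av k', ∀ x' ∈ Bv k', (c + p - x) % p ≠ (c' + p - x') % p)
    (hwXZ : ∀ l k, good l → good k → ∀ a₁ ∈ Av l, ∀ y ∈ Bv l, ∀ c ∈ Cv k, ∀ a₂ ∈ Av k, ¬(l = k ∧ a₁ = a₂) →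
      ((a₁ + p - y) % p + (c + p - a₂) % p) % p ∉ YL)
    (hwYX : ∀ j l, good j → good l → ∀ c ∈ Cv j, ∀ b₁ ∈ Bv j, ∀ x ∈ Av l, ∀ b₂ ∈ Bv l, ¬(j = l ∧ b₁ = b₂) →
      ((c + p - b₁) % p + p - (x + p - b₂) % p) % p ∉ ZL)
    (hwYZ : ∀ j k l, good j → good k → good l → ∀ c₁ ∈ Cv j, ∀ y ∈ Bv j, ∀ c₂ ∈ Cv k, ∀ x ∈ Av k, ∀ x' ∈ Av l, ∀ y' ∈ Bv l,
      ¬(j = k ∧ k = l ∧ c₁ = c₂) → ((c₁ + p - y) % p + p - (c₂ + p - x) % p) % p ≠ (x' + p - y') % p)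
    (hcY : ∀ y ∈ YL, ∃ k, good k ∧ ∃ c ∈ Cv k, ∃ x ∈ Bv k, (c + p - x) % p = y)
    (hcZ : ∀ t ∈ ZL, ∃ k, good k ∧ ∃ c ∈ Cv k, ∃ x ∈ Av k, (c + p - x) % p = t)
    (ks : List ι) (hks : ks.Nodup) (hksg : ∀ k, k ∈ ks ↔ good k) :
    existsCoverW p YL ZL (ks.map fun k => blockDiffsW p YL ZL (sz k).1 (sz k).2.1 (sz k).2.2) [] [] [] = true := by
  classical
  -- lists realising every good block
  have hex : ∀ k, ∃ L3 : List ℕ × List ℕ × List ℕ, good k →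
      (∀ x, x ∈ L3.1 ↔ x ∈ Av k) ∧ (∀ x, x ∈ L3.2.1 ↔ x ∈ Bv k) ∧ (∀ x, x ∈ L3.2.2 ↔ x ∈ Cv k) ∧
      (diffList p L3.2.2 L3.2.1, diffList p L3.2.2 L3.1, diffList p L3.1 L3.2.1) ∈ blockDiffsW p YL ZL (sz k).1 (sz k).2.1 (sz k).2.2 := by
    intro k
    by_cases hg : good k
    · obtain ⟨Al, Bl, Cl, hA, hB, hC, hmem⟩ := exists_lists_mem_blockDiffsW hYL (Av k) (Bv k) (Cv k) (hszA k hg) (hszB k hg) (hszC k hg)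
        (hAp k) (hBp k) (hCp k) (hB0 k hg) (hY k hg) (hZ k hg) (hinjY k hg) (hinjZ k hg) (hinjX k hg)
        (fun a₁ ha₁ a₂ ha₂ hne y hy c hc => hwXZ k k hg hg a₁ ha₁ y hy c hc a₂ ha₂ (fun h => hne h.2))
        (fun b₁ hb₁ b₂ hb₂ hne c hc x hx => hwYX k k hg hg c hc b₁ hb₁ x hx b₂ hb₂ (fun h => hne h.2))
        (fun c₁ hc₁ c₂ hc₂ hne y hy x hx x' hx' y' hy' => hwYZ k k k hg hg hg c₁ hc₁ y hy c₂ hc₂ x hx x' hx' y' hy' (fun h => hne h.2.2))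
      exact ⟨(Al, Bl, Cl), fun _ => ⟨hA, hB, hC, hmem⟩⟩
    · exact ⟨([], [], []), fun h => absurd h hg⟩
  choose L3 hL3 using hex
  -- membership in the difference lists
  have hDY : ∀ k, good k → ∀ y, y ∈ diffList p (L3 k).2.2 (L3 k).2.1 ↔ ∃ c ∈ Cv k, ∃ x ∈ Bv k, (c + p - x) % p = y := by
    intro k hg y
    rw [mem_diffList]
    constructor
    · rintro ⟨c, hc, x, hx, h⟩; exact ⟨c, ((hL3 k hg).2.2.1 c).1 hc, x, ((hL3 k hg).2.1 x).1 hx, h⟩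
    · rintro ⟨c, hc, x, hx, h⟩; exact ⟨c, ((hL3 k hg).2.2.1 c).2 hc, x, ((hL3 k hg).2.1 x).2 hx, h⟩
  have hDZ : ∀ k, good k → ∀ t, t ∈ diffList p (L3 k).2.2 (L3 k).1 ↔ ∃ c ∈ Cv k, ∃ x ∈ Av k, (c + p - x) % p = t := by
    intro k hg t
    rw [mem_diffList]
    constructor
    · rintro ⟨c, hc, x, hx, h⟩; exact ⟨c, ((hL3 k hg).2.2.1 c).1 hc, x, ((hL3 k hg).1 x).1 hx, h⟩
    · rintro ⟨c, hc, x, hx, h⟩; exact ⟨c, ((hL3 k hg).2.2.1 c).2 hc, x, ((hL3 k hg).1 x).2 hx, h⟩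
  have hDX : ∀ k, good k → ∀ x, x ∈ diffList p (L3 k).1 (L3 k).2.1 ↔ ∃ c ∈ Av k, ∃ y ∈ Bv k, (c + p - y) % p = x := by
    intro k hg x
    rw [mem_diffList]
    constructor
    · rintro ⟨c, hc, y, hy, h⟩; exact ⟨c, ((hL3 k hg).1 c).1 hc, y, ((hL3 k hg).2.1 y).1 hy, h⟩
    · rintro ⟨c, hc, y, hy, h⟩; exact ⟨c, ((hL3 k hg).1 c).2 hc, y, ((hL3 k hg).2.1 y).2 hy, h⟩
  have hmain := existsCoverW_complete_list (p := p) (YL := YL) (ZL := ZL) good (fun k => (L3 k).1) (fun k => (L3 k).2.1) (fun k => (L3 k).2.2)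
    (fun k => blockDiffsW p YL ZL (sz k).1 (sz k).2.1 (sz k).2.2) (fun k hg => (hL3 k hg).2.2.2) ?_ ?_ ?_ ?_ ?_ ?_ ?_ ?_ ks hks (fun k hk => (hksg k).1 hk)
    [] [] [] (by simp) (by simp) (by simp) (fun k hg hk => absurd ((hksg k).2 hg) hk) (fun k hg hk => absurd ((hksg k).2 hg) hk)
  · exact hmain
  · intro k k' hg hg' hne y hy hy'
    obtain ⟨c, hc, x, hx, rfl⟩ := (hDY k hg y).1 hy
    obtain ⟨c', hc', x', hx', h⟩ := (hDY k' hg' _).1 hy'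
    exact hdY k k' hg hg' hne c hc x hx c' hc' x' hx' h.symm
  · intro k k' hg hg' hne t ht ht'
    obtain ⟨c, hc, x, hx, rfl⟩ := (hDZ k hg t).1 ht
    obtain ⟨c', hc', x', hx', h⟩ := (hDZ k' hg' _).1 ht'
    exact hdZ k k' hg hg' hne c hc x hx c' hc' x' hx' h.symm
  · intro k k' hg hg' hne x hx hx'
    obtain ⟨c, hc, y, hy, rfl⟩ := (hDX k hg x).1 hx
    obtain ⟨c', hc', y', hy', h⟩ := (hDX k' hg' _).1 hx'
    exact hdX k k' hg hg' hne c hc y hy c' hc' y' hy' h.symm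
  · intro l k hgl hgk hne x hx t ht
    obtain ⟨a₁, ha₁, y, hy, rfl⟩ := (hDX l hgl x).1 hx
    obtain ⟨c, hc, a₂, ha₂, rfl⟩ := (hDZ k hgk t).1 ht
    exact hwXZ l k hgl hgk a₁ ha₁ y hy c hc a₂ ha₂ (fun h => hne h.1)
  · intro j l hgj hgl hne y hy x hx
    obtain ⟨c, hc, b₁, hb₁, rfl⟩ := (hDY j hgj y).1 hy
    obtain ⟨x', hx', b₂, hb₂, rfl⟩ := (hDX l hgl x).1 hx
    exact hwYX j l hgj hgl c hc b₁ hb₁ x' hx' b₂ hb₂ (fun h => hne h.1)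
  · intro j k l hgj hgk hgl hne y hy t ht hmem
    obtain ⟨c₁, hc₁, y', hy', rfl⟩ := (hDY j hgj y).1 hy
    obtain ⟨c₂, hc₂, x, hx, rfl⟩ := (hDZ k hgk t).1 ht
    obtain ⟨x', hx', y'', hy'', h⟩ := (hDX l hgl _).1 hmem
    exact hwYZ j k l hgj hgk hgl c₁ hc₁ y' hy' c₂ hc₂ x hx x' hx' y'' hy'' (fun h' => hne ⟨h'.1, h'.2.1⟩) h.symm
  · intro y hy
    obtain ⟨k, hg, h⟩ := hcY y hy
    exact ⟨k, hg, (hDY k hg y).2 h⟩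
  · intro t ht
    obtain ⟨k, hg, h⟩ := hcZ t ht
    exact ⟨k, hg, (hDZ k hg t).2 h⟩

end Sound

end Summit.MatrixMultiplication.OmegaCensus.CubeNB
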